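import Mathlib
import HarnessLib
import Literature.MathematicalPhysics.QuantumFieldTheory.Balaban1983to89.B13Contraction113
import Literature.MathematicalPhysics.QuantumFieldTheory.Balaban1983to89.B12Lineariz267
import Literature.MathematicalPhysics.QuantumFieldTheory.Balaban1983to89.B12LinearizAnalytic267
import Literature.MathematicalPhysics.QuantumFieldTheory.Balaban1983to89.MatrixLog
import Literature.Analysis.Matrix.DetExp

/-!
# B12 [Balaban1987RG1] (2.12) p. 268 — the term «Tr log(I − h((δ/δB)D̃)(g_kCB))»: the logarithm of the Jacobian
# operator `DΦ(B) = I − h∘DD̃(B)` of the linearizing change of variables `Φ(B) = B − hD̃(B)` as an ANALYTIC function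
# of `B` on `‖B‖ < ε`, vanishing at `B = 0`, with `exp (log DΦ(B)) = DΦ(B)`, a size, and — in finite dimension —
# `exp (Tr log DΦ(B)) = det DΦ(B)` (the Jacobian identity behind (2.12))

CITATION. T. Bałaban, *Renormalization group approach to lattice gauge field theories. I. Generation of effective
actions in a small field approximation and a coupling constant renormalization in four dimensions*, Commun. Math.
Phys. 109 (1987) 249–301 [Balaban1987RG1] ("B12" of the cell), p. 267 and (2.12)–(2.14) p. 268 (renders
`…1987-cmp109-rg-I-small-field-p019`, `-p020`; PDF page = journal page − 248); the template [15] = T. Bałaban,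
*The variational problem and background fields in renormalization group method for lattice gauge theories*, CMP 102
(1985) 277–309, Sect. C p. 286 [Balaban1985Variational] (render `…1985-cmp102-variational-background-p010`), quoted
for the contraction constant only.  This file sits on top of the tree leaves `B12Lineariz267` (the algebra of the substitution `B′ = B − hD̃(B)`, `D̃` BY NAME from the contraction module
`B13Contraction113`) and `B12LinearizAnalytic267` (joint analyticity of `D̃`, the derivative `DD̃(B)` with
`‖h∘DD̃(B)‖ ≤ 9C₂b‖B‖(1 − 9C₂bε)⁻¹`, the strict derivative `DΦ(B) = I − h∘DD̃(B)` of `Φ`), and of the tree's operator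
logarithm `MatrixLog` (`mlog X = logOnePlus (X − 1)`, `exp (mlog X) = X` and analyticity on `‖X − 1‖ < 1`, the size
`‖mlog X‖ ≤ −log(1 − ‖X − 1‖)`) and Liouville formula `Literature.Analysis.Matrix.det_exp_eq_exp_trace`.  All four are
imported and used BY NAME; nothing of them is re-derived.

THE PRINT (verbatim).  B12 p. 267 [PDF 19]: *«We are looking for an analytic, 𝐠-valued function D̃(B′), defined at
bonds of T⁽ᵏ⁺¹⁾, and such that the transformation B′ = B − hD̃(B) linearizes the function Q̃(B′). The function D̃(B)
is determined by the equation LQ̃B′ + C̃(B′) = LQ̃B − D̃(B) + C̃(B − hD̃(B)) = LQ̃B. It is easy to prove, following the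
proofs in the above mentioned papers, that there exists exactly one solution of this equation, and that it is an
analytic function of B.»*  B12 p. 268 [PDF 20]: *«After these transformations we obtain the following expression for
the new action:»* — formula (2.12), whose fluctuation integral is
`log N_k″⁻¹ ∫ dμ_{C⁽ᵏ⁾}(B) χ_k exp[ Tr log(I − h((δ/δB)D̃)(g_kCB)) + log σ(g_kCB − hD̃(g_kCB)) + (1/g_k²)⟨H₁hD̃₃(g_kCB), J⟩ − (1/g_k²)G₃(g_kB) + … + {E_k(U_k(exp i[g_kCB − hD̃(g_kCB)]V⁽ᵏ⁾)) − E_k(U_k(V⁽ᵏ⁾))} ]`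
— then: *«Let us notice that the normalization constant N_k″ is equal to the integral above at U_{k+1} = 1. The
expression under the exponential is clearly a sum of two terms, one is connected with the expansion of the action
−(1/g_k²)A(U_k(V)) and the measure in (2.1), and we denote it by 𝐏⁽ᵏ⁾(g_k, U_{k+1}, B), another is the expression in
the curly bracket {…}. The integral in (2.12) defines the new term 𝐄⁽ᵏ⁺¹⁾ in the inductive definition of the action
A_{k+1} by the formula»* (2.13) `𝐄⁽ᵏ⁺¹⁾(g_k, U_{k+1}) = log ∫ dμ_{C⁽ᵏ⁾}(B) χ_k exp[𝐏⁽ᵏ⁾(g_k, U_{k+1}, B) + {…}]`,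
*«Let us remark that the expression under the exponential above vanishes at g_k = 0, and log N_k″ = 𝐄⁽ᵏ⁺¹⁾(g_k, 1).
(2.14)»*.  READING (cell GAPS C-adv7-115: (2.12) prints the Jacobian of `B′ = B − hD̃(B)` as
`Tr log(I − h(δ/δB)D̃)(g_kCB) + log σ(…)`): `I − h((δ/δB)D̃)` is the derivative `DΦ` of the substitution, and
`Tr log DΦ` is the logarithm of its Jacobian determinant, `det DΦ = exp Tr log DΦ`; this term of 𝐏⁽ᵏ⁾ is an analytic
function of the (complex) field `B` on the analyticity domain of `D̃`, and it vanishes at `B = 0` (`DD̃(0) = 0`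
because `D̃ = O(‖B‖²)`), which is this term's share of «vanishes at g_k = 0» (the argument is `g_kCB`).

THE TYPING (schematic, as in `B12Lineariz267` / `B12LinearizAnalytic267` — cell DIVERGENCE row for this file).
`𝒴`, `𝒳` complex Banach spaces of configurations on bonds of `T⁽ᵏ⁾`, `T⁽ᵏ⁺¹⁾`; `hop : 𝒳 →ₗ[ℂ] 𝒴` (print's `h`)
with `‖hop X‖ ≤ b‖X‖`, entering derivatives as the continuous linear map `hop.mkContinuous b hHop`; `Ct : 𝒴 → 𝒳`
(print's `C̃`) with `B13Contraction113.QuadAnalytic Ct C₂ R` and `AnalyticOnNhd ℂ Ct {‖Y‖ < R}`; `3ε ≤ R`; the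
contraction constant in the form of the template [15] p. 286 «for example we take 9C₂B₀ε₃ ≦ 1/2»: `9C₂bε ≤ 1/2`;
`D̃` HYPOTHESIS-STYLE: any `Dt : 𝒴 → 𝒳` with `Dt B ∈ closedBall 0 (4C₂ε²)` and `Ct (B − hop (Dt B)) = Dt B` on
`‖B‖ < ε` (`B12Lineariz267.exists_Dt`).  The JACOBIAN OPERATOR is the element
`J(B) := hop.mkContinuous b hHop ∘L fderiv ℂ Dt B` of the Banach algebra `𝒴 →L[ℂ] 𝒴`, `DΦ(B) = 1 − J(B)`
(`B12LinearizAnalytic267.hasStrictFDerivAt_phi`), and the print's `log` is the tree's operator logarithm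
`MatrixLog.mlog` (the power series `Σ (−1)ⁿ⁺¹(X − 1)ⁿ/n`, [Balaban1985Averaging] (21)); the print's `Tr` is, in finite
dimension (§4: `[FiniteDimensional ℂ 𝒴]`, automatic on the finite lattice), Mathlib's `LinearMap.trace ℂ 𝒴`, and
the Jacobian determinant is `LinearMap.det`.  No definitions are introduced: all objects are written out.

CONTENTS.  §1 [folklore] OPERATOR CALCULUS of `log (1 − J)` in a complete normed `ℂ`-algebra `𝔄`: for ‖J‖ < 1,
`mlog (1 − J) = logOnePlus (−J)`, `exp (mlog (1 − J)) = 1 − J`, `mlog (1 − 0) = 0`, analyticity of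
`J ↦ mlog (1 − J)` at every ‖J‖ < 1 and of `x ↦ mlog (1 − A x)` for an analytic operator-valued `A` with ‖A x‖ < 1,
the sizes `‖mlog (1 − J)‖ ≤ −log(1 − ‖J‖) ≤ −log(1 − t)` for `‖J‖ ≤ t < 1`, `≤ ‖J‖/(1 − ‖J‖)`, `≤ 2‖J‖` for
‖J‖ ≤ 1/2, and `‖τ (mlog (1 − J))‖ ≤ ‖τ‖·(−log(1 − ‖J‖))` for a continuous linear `τ` (all from `MatrixLog` /
`Literature.Analysis.Complex.LogOnePlus` by name).  §2 [folklore] the JACOBIAN OPERATOR: `B ↦ fderiv ℂ Dt B` and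
`B ↦ J(B)` are ANALYTIC on `ball 0 ε` (`B12LinearizAnalytic267.analyticOnNhd_Dt` + Mathlib `AnalyticOnNhd.fderiv` +
`ContinuousLinearMap.compL`), `fderiv ℂ Dt 0 = 0` and `J(0) = 0` (from `‖DD̃(B)‖ ≤ 9C₂‖B‖(1 − 9C₂bε)⁻¹`),
`‖J(B)‖ ≤ 18C₂b‖B‖ < 1` on `‖B‖ < ε` under `9C₂bε ≤ 1/2`, and `fderiv ℂ Φ B = 1 − J(B)`.  §3 [folklore] the TERM
`log DΦ(B) := mlog (1 − J(B))`: analytic on `ball 0 ε` (operator-valued), `= 0` at `B = 0`,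
`exp (mlog (1 − J(B))) = 1 − J(B) = fderiv ℂ Φ B`, `‖mlog (1 − J(B))‖ ≤ −log(1 − 18C₂b‖B‖)` (`≤ 36C₂b‖B‖` on
`‖B‖ ≤ ε/2`); for every continuous linear `τ : (𝒴 →L[ℂ] 𝒴) →L[ℂ] F` (the trace being the case of interest),
`B ↦ τ (log DΦ(B))` is analytic on the ball, vanishes at `0`, and `‖τ (log DΦ(B))‖ ≤ ‖τ‖·(−log(1 − 18C₂b‖B‖))`.
§4 [folklore] FINITE DIMENSION (`[FiniteDimensional ℂ 𝒴]`): the trace `T ↦ Tr T` is continuous on `𝒴 →L[ℂ] 𝒴`;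
LIOUVILLE AT OPERATOR LEVEL `det (exp X) = exp (Tr X)` for `X : 𝒴 →L[ℂ] 𝒴` (transfer of `exp` through the
continuous ring homomorphism `LinearMap.toMatrix` by Mathlib `NormedSpace.map_exp_of_mem_ball`, then the tree's
matrix Liouville formula `det_exp_eq_exp_trace`, `LinearMap.det_toMatrix`, `LinearMap.trace_eq_matrix_trace`); hence
`exp (Tr mlog T) = det T` for ‖T − 1‖ < 1, and for the Jacobian: `exp (Tr log DΦ(B)) = det DΦ(B) = det (fderiv ℂ Φ B)`,
`det DΦ(B) ≠ 0`, `det DΦ(0) = 1`, `Tr log DΦ(0) = 0`, `B ↦ Tr log DΦ(B)` and `B ↦ det DΦ(B)` analytic on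
`ball 0 ε`; the INTRINSIC TRACE BOUND `|Tr T| ≤ dim 𝒴 · ‖T‖` for the operator norm of any norm on `𝒴` (the trace is
the sum of the `dim 𝒴` roots of the characteristic polynomial, Mathlib `Module.End.trace_eq_sum_roots_charpoly_of_splits`,
each root lies in the spectrum, `Module.End.mem_spectrum_iff_isRoot_charpoly` + `ContinuousLinearMap.spectrum_eq`,
and the spectrum in the ball of radius `‖T‖`, `spectrum.norm_le_norm_mul_of_mem`), whence the sizes
`|Tr log DΦ(B)| ≤ dim 𝒴 · (−log(1 − 18C₂b‖B‖))` on `‖B‖ < ε` and `≤ 36 · dim 𝒴 · C₂b‖B‖` on `‖B‖ ≤ ε/2` — the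
print-style shape (number of variables) × O(1) (also the form with the operator norm `‖Tr‖` of the trace
functional).  §5 TWO transcription theorems [cite] (operator part; trace/determinant part in finite dimension)
assembling the (2.12) term in this typing for the `D̃` of `B12Lineariz267.p267_linearizing_change_of_variables` /
`B12LinearizAnalytic267.p267_analytic_function_of_B`, and a degenerate model showing their hypotheses are jointly
satisfiable.  NOT TYPED: the identification of `Tr mlog DΦ(B)`
with the principal branch `Complex.log (det DΦ(B))` (both exponentiate to `det DΦ(B)` and vanish at `B = 0`; the
block form `log det(1 − M)` with its size is the tree's `B13PkLocalTerms.norm_log_det_one_sub_le`), the reality of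
`Tr log DΦ(B)` and `det DΦ(B) > 0` for real (𝐠-valued) `B`, the sizes of the real domains (2.9), the lattice formula
of `h` (p. 267: «(hB)(b₀(c)) = h(c)B(c)»), the other terms of 𝐏⁽ᵏ⁾ and the measure `dμ_{C⁽ᵏ⁾}`.  Everything is
[folklore] functional analysis / linear algebra except §5; nothing of [B12] is asserted; NOT summit progress.
-/

open Metric Set Filter Topology NormedSpace

namespace Literature.MathematicalPhysics.QuantumFieldTheory.Balaban1983to89.B12JacobianTrLog268

open Literature.MathematicalPhysics.QuantumFieldTheory.Balaban1983to89.B13Contraction113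
open Literature.MathematicalPhysics.QuantumFieldTheory.Balaban1983to89.B12Lineariz267
open Literature.MathematicalPhysics.QuantumFieldTheory.Balaban1983to89.B12LinearizAnalytic267
open Literature.MathematicalPhysics.QuantumFieldTheory.Balaban1983to89.MatrixLog

/-! ## §1  Operator calculus of `log (1 − J)` in a complete normed `ℂ`-algebra -/

section operator

variable {𝔄 : Type*} [NormedRing 𝔄] [NormedAlgebra ℂ 𝔄]

omit [NormedAlgebra ℂ 𝔄] in
/-- `‖(1 − J) − 1‖ = ‖J‖`. [folklore] -/
@[simp] theorem norm_one_sub_sub_one (J : 𝔄) : ‖(1 - J) - 1‖ = ‖J‖ := by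
  rw [sub_sub_cancel_left, norm_neg]

/-- `log (1 − J) = logOnePlus (−J)` (the series `−Σ Jⁿ/n`). [folklore] -/
theorem mlog_one_sub (J : 𝔄) : mlog (1 - J) = Literature.Analysis.Complex.logOnePlus (-J) := by
  rw [mlog_def, sub_sub_cancel_left]

/-- `log (1 − 0) = 0`. [folklore] -/
@[simp] theorem mlog_one_sub_zero : mlog (1 - (0 : 𝔄)) = 0 := by
  rw [sub_zero, mlog_one]

variable [CompleteSpace 𝔄]

/-- `exp (log (1 − J)) = 1 − J` for ‖J‖ < 1 (`MatrixLog.exp_mlog`). [folklore] -/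
theorem exp_mlog_one_sub {J : 𝔄} (hJ : ‖J‖ < 1) : exp (mlog (1 - J)) = 1 - J :=
  exp_mlog (by rwa [norm_one_sub_sub_one])

/-- `‖log (1 − J)‖ ≤ −log(1 − ‖J‖)` for ‖J‖ < 1 (`MatrixLog.norm_mlog_le_neg_log`). [folklore] -/
theorem norm_mlog_one_sub_le_neg_log {J : 𝔄} (hJ : ‖J‖ < 1) : ‖mlog (1 - J)‖ ≤ -Real.log (1 - ‖J‖) := by
  have h := norm_mlog_le_neg_log (X := 1 - J) (by rwa [norm_one_sub_sub_one])
  rwa [norm_one_sub_sub_one] at h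

/-- `‖log (1 − J)‖ ≤ −log(1 − t)` whenever `‖J‖ ≤ t < 1` (the majorant `−log(1 − ·)` is monotone; its further bound
`−log(1 − t) ≤ t/(1 − t)` is the tree's `B10Eq29CplxLine.neg_log_one_sub_le`). [folklore] -/
theorem norm_mlog_one_sub_le_neg_log_of_le {J : 𝔄} {t : ℝ} (hJ : ‖J‖ ≤ t) (ht : t < 1) :
    ‖mlog (1 - J)‖ ≤ -Real.log (1 - t) :=
  (norm_mlog_one_sub_le_neg_log (hJ.trans_lt ht)).trans
    (neg_le_neg (Real.log_le_log (by linarith) (by linarith [norm_nonneg J])))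

/-- `‖log (1 − J)‖ ≤ ‖J‖/(1 − ‖J‖)` for ‖J‖ < 1 (`MatrixLog.norm_mlog_le_div`). [folklore] -/
theorem norm_mlog_one_sub_le_div {J : 𝔄} (hJ : ‖J‖ < 1) : ‖mlog (1 - J)‖ ≤ ‖J‖ / (1 - ‖J‖) := by
  have h := norm_mlog_le_div (X := 1 - J) (by rwa [norm_one_sub_sub_one])
  rwa [norm_one_sub_sub_one] at h

/-- `‖log (1 − J)‖ ≤ 2‖J‖` for ‖J‖ ≤ 1/2 (`MatrixLog.norm_mlog_le_two_mul`). [folklore] -/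
theorem norm_mlog_one_sub_le_two_mul {J : 𝔄} (hJ : ‖J‖ ≤ 1 / 2) : ‖mlog (1 - J)‖ ≤ 2 * ‖J‖ := by
  have h := norm_mlog_le_two_mul (X := 1 - J) (by rwa [norm_one_sub_sub_one])
  rwa [norm_one_sub_sub_one] at h

/-- `J ↦ log (1 − J)` is complex-analytic at every ‖J‖ < 1 (`MatrixLog.analyticAt_mlog` composed with the affine
map `J ↦ 1 − J`). [folklore] -/
theorem analyticAt_mlog_one_sub {J : 𝔄} (hJ : ‖J‖ < 1) : AnalyticAt ℂ (fun K : 𝔄 => mlog (1 - K)) J := by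
  have h1 : AnalyticAt ℂ (fun K : 𝔄 => (1 : 𝔄) - K) J := analyticAt_const.sub analyticAt_id
  have h2 : AnalyticAt ℂ (mlog : 𝔄 → 𝔄) (1 - J) := analyticAt_mlog (by rwa [norm_one_sub_sub_one])
  exact h2.comp h1

/-- `J ↦ log (1 − J)` is analytic on a neighbourhood of every point of the unit ball. [folklore] -/
theorem analyticOnNhd_mlog_one_sub : AnalyticOnNhd ℂ (fun K : 𝔄 => mlog (1 - K)) (ball (0 : 𝔄) 1) :=
  fun _ hJ => analyticAt_mlog_one_sub (mem_ball_zero_iff.mp hJ)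

variable {E : Type*} [NormedAddCommGroup E] [NormedSpace ℂ E]

/-- Composition: if `A : E → 𝔄` is analytic on (a neighbourhood of every point of) `s` with ‖A x‖ < 1 on `s`, then
`x ↦ log (1 − A x)` is analytic there. [folklore] -/
theorem analyticOnNhd_mlog_one_sub_comp {A : E → 𝔄} {s : Set E} (hA : AnalyticOnNhd ℂ A s)
    (hAs : ∀ x ∈ s, ‖A x‖ < 1) : AnalyticOnNhd ℂ (fun x => mlog (1 - A x)) s :=
  fun x hx => (analyticAt_mlog_one_sub (hAs x hx)).comp (hA x hx)

variable {F : Type*} [NormedAddCommGroup F] [NormedSpace ℂ F]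

/-- A continuous linear `τ` (e.g. the trace in finite dimension) of `log (1 − J)`:
`‖τ (log (1 − J))‖ ≤ ‖τ‖·(−log(1 − ‖J‖))`. [folklore] -/
theorem norm_clm_mlog_one_sub_le (τ : 𝔄 →L[ℂ] F) {J : 𝔄} (hJ : ‖J‖ < 1) :
    ‖τ (mlog (1 - J))‖ ≤ ‖τ‖ * (-Real.log (1 - ‖J‖)) :=
  (τ.le_opNorm _).trans (mul_le_mul_of_nonneg_left (norm_mlog_one_sub_le_neg_log hJ) (norm_nonneg _))

/-- … and if `A : E → 𝔄` is analytic on `s` with ‖A x‖ < 1 there, `x ↦ τ (log (1 − A x))` is analytic on `s`.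
[folklore] -/
theorem analyticOnNhd_clm_mlog_one_sub_comp (τ : 𝔄 →L[ℂ] F) {A : E → 𝔄} {s : Set E}
    (hA : AnalyticOnNhd ℂ A s) (hAs : ∀ x ∈ s, ‖A x‖ < 1) :
    AnalyticOnNhd ℂ (fun x => τ (mlog (1 - A x))) s :=
  τ.comp_analyticOnNhd (analyticOnNhd_mlog_one_sub_comp hA hAs)

end operator

/-! ## §2a  Arithmetic of the contraction constant `9C₂bε ≤ 1/2` ([15] p. 286 «for example we take 9C₂B₀ε₃ ≦ 1/2») -/

section arithmetic

variable {C₂ b ε : ℝ}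

/-- `9C₂bε ≤ 1/2 ⇒ 9C₂bε < 1`. [folklore] -/
theorem lt_one_of_le_half (hq2 : 9 * C₂ * b * ε ≤ 1 / 2) : 9 * C₂ * b * ε < 1 := by linarith

/-- Under `9C₂bε ≤ 1/2`: `9C₂bt(1 − 9C₂bε)⁻¹ ≤ 18C₂bt` for `t ≥ 0`. [folklore] -/
theorem bound_le_eighteen (hC₂ : 0 ≤ C₂) (hb : 0 ≤ b) (hq2 : 9 * C₂ * b * ε ≤ 1 / 2) {t : ℝ} (ht : 0 ≤ t) :
    9 * C₂ * b * t * (1 - 9 * C₂ * b * ε)⁻¹ ≤ 18 * C₂ * b * t := by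
  have hinv : (1 - 9 * C₂ * b * ε)⁻¹ ≤ 2 := by
    rw [inv_le_comm₀ (by linarith) (by norm_num)]; linarith
  have h9 : 0 ≤ 9 * C₂ * b * t := by positivity
  calc 9 * C₂ * b * t * (1 - 9 * C₂ * b * ε)⁻¹ ≤ 9 * C₂ * b * t * 2 := by gcongr
    _ = 18 * C₂ * b * t := by ring

/-- Under `9C₂bε ≤ 1/2`: `18C₂bt < 1` for `t < ε`. [folklore] -/
theorem eighteen_lt_one (hC₂ : 0 ≤ C₂) (hb : 0 ≤ b) (hq2 : 9 * C₂ * b * ε ≤ 1 / 2) {t : ℝ} (htε : t < ε) :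
    18 * C₂ * b * t < 1 := by
  have h9 : 0 ≤ 9 * C₂ * b := by positivity
  rcases h9.eq_or_lt with h0 | hpos
  · have : 18 * C₂ * b * t = 2 * (9 * C₂ * b) * t := by ring
    rw [this, ← h0]; norm_num
  · have : 9 * C₂ * b * t < 9 * C₂ * b * ε := mul_lt_mul_of_pos_left htε hpos
    linarith

/-- Under `9C₂bε ≤ 1/2`: `18C₂bt ≤ 1/2` for `t ≤ ε/2`. [folklore] -/
theorem eighteen_le_half (hC₂ : 0 ≤ C₂) (hb : 0 ≤ b) (hq2 : 9 * C₂ * b * ε ≤ 1 / 2) {t : ℝ} (htε : t ≤ ε / 2) :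
    18 * C₂ * b * t ≤ 1 / 2 := by
  have h9 : 0 ≤ 9 * C₂ * b := by positivity
  have : 18 * C₂ * b * t = 9 * C₂ * b * (2 * t) := by ring
  rw [this]
  calc 9 * C₂ * b * (2 * t) ≤ 9 * C₂ * b * ε := by gcongr; linarith
    _ ≤ 1 / 2 := hq2

end arithmetic

/-! ## §2  The Jacobian operator `J(B) = h∘DD̃(B)` is analytic on `‖B‖ < ε`, `J(0) = 0`, `‖J(B)‖ ≤ 18C₂b‖B‖ < 1` -/

section jacobian

variable {𝒳 𝒴 : Type*} [NormedAddCommGroup 𝒳] [NormedSpace ℂ 𝒳] [CompleteSpace 𝒳]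
  [NormedAddCommGroup 𝒴] [NormedSpace ℂ 𝒴] [CompleteSpace 𝒴]
  {hop : 𝒳 →ₗ[ℂ] 𝒴} {Ct : 𝒴 → 𝒳} {C₂ R b ε : ℝ} {Dt : 𝒴 → 𝒳}

/-- **`DD̃(0) = 0`**: the derivative of `D̃` vanishes at the origin (from `‖DD̃(B₀)‖ ≤ 9C₂‖B₀‖(1 − 9C₂bε)⁻¹`,
`B12LinearizAnalytic267.norm_fderiv_Dt_le` — «D̃(B) has an expansion beginning with quadratic terms»). [folklore] -/
theorem fderiv_Dt_zero (hC : QuadAnalytic Ct C₂ R) (hCa : AnalyticOnNhd ℂ Ct {Y : 𝒴 | ‖Y‖ < R})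
    (hC₂ : 0 ≤ C₂) (hb : 0 ≤ b) (hHop : ∀ X, ‖hop X‖ ≤ b * ‖X‖) (hq : 9 * C₂ * b * ε < 1)
    (hRC : 3 * ε ≤ R) (hDball : ∀ B : 𝒴, ‖B‖ < ε → Dt B ∈ closedBall (0:𝒳) (4 * C₂ * ε ^ 2))
    (hDfix : ∀ B : 𝒴, ‖B‖ < ε → Ct (B - hop (Dt B)) = Dt B) (hε : 0 < ε) :
    fderiv ℂ Dt (0 : 𝒴) = 0 := by
  have h := norm_fderiv_Dt_le hC hCa hC₂ hb hHop hq hRC hDball hDfix (B₀ := 0) (by rwa [norm_zero])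
  have h0 : ‖fderiv ℂ Dt (0 : 𝒴)‖ ≤ 0 := by simpa using h
  exact norm_le_zero_iff.mp h0

/-- **`J(0) = h∘DD̃(0) = 0`.** [folklore] -/
theorem jacobianOp_zero (hC : QuadAnalytic Ct C₂ R) (hCa : AnalyticOnNhd ℂ Ct {Y : 𝒴 | ‖Y‖ < R})
    (hC₂ : 0 ≤ C₂) (hb : 0 ≤ b) (hHop : ∀ X, ‖hop X‖ ≤ b * ‖X‖) (hq : 9 * C₂ * b * ε < 1)
    (hRC : 3 * ε ≤ R) (hDball : ∀ B : 𝒴, ‖B‖ < ε → Dt B ∈ closedBall (0:𝒳) (4 * C₂ * ε ^ 2))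
    (hDfix : ∀ B : 𝒴, ‖B‖ < ε → Ct (B - hop (Dt B)) = Dt B) (hε : 0 < ε) :
    hop.mkContinuous b hHop ∘L fderiv ℂ Dt (0 : 𝒴) = 0 := by
  rw [fderiv_Dt_zero hC hCa hC₂ hb hHop hq hRC hDball hDfix hε, ContinuousLinearMap.comp_zero]

/-- **`B ↦ DD̃(B)` is analytic on `‖B‖ < ε`** (operator-valued; Mathlib `AnalyticOnNhd.fderiv` on
`B12LinearizAnalytic267.analyticOnNhd_Dt`, `𝒳` complete). [folklore] -/
theorem analyticOnNhd_fderiv_Dt (hC : QuadAnalytic Ct C₂ R) (hCa : AnalyticOnNhd ℂ Ct {Y : 𝒴 | ‖Y‖ < R})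
    (hC₂ : 0 ≤ C₂) (hb : 0 ≤ b) (hHop : ∀ X, ‖hop X‖ ≤ b * ‖X‖) (hq : 9 * C₂ * b * ε < 1)
    (hRC : 3 * ε ≤ R) (hDball : ∀ B : 𝒴, ‖B‖ < ε → Dt B ∈ closedBall (0:𝒳) (4 * C₂ * ε ^ 2))
    (hDfix : ∀ B : 𝒴, ‖B‖ < ε → Ct (B - hop (Dt B)) = Dt B) :
    AnalyticOnNhd ℂ (fderiv ℂ Dt) (ball (0:𝒴) ε) :=
  (analyticOnNhd_Dt hC hCa hC₂ hb hHop hq hRC hDball hDfix).fderiv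

/-- **The Jacobian operator `B ↦ J(B) = h∘DD̃(B)` is analytic on `‖B‖ < ε`** with values in the Banach algebra
`𝒴 →L[ℂ] 𝒴` (post-composition with the continuous linear `compL h`). [folklore] -/
theorem analyticOnNhd_jacobianOp (hC : QuadAnalytic Ct C₂ R) (hCa : AnalyticOnNhd ℂ Ct {Y : 𝒴 | ‖Y‖ < R})
    (hC₂ : 0 ≤ C₂) (hb : 0 ≤ b) (hHop : ∀ X, ‖hop X‖ ≤ b * ‖X‖) (hq : 9 * C₂ * b * ε < 1)
    (hRC : 3 * ε ≤ R) (hDball : ∀ B : 𝒴, ‖B‖ < ε → Dt B ∈ closedBall (0:𝒳) (4 * C₂ * ε ^ 2))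
    (hDfix : ∀ B : 𝒴, ‖B‖ < ε → Ct (B - hop (Dt B)) = Dt B) :
    AnalyticOnNhd ℂ (fun B : 𝒴 => hop.mkContinuous b hHop ∘L fderiv ℂ Dt B) (ball (0:𝒴) ε) := by
  have h := (ContinuousLinearMap.compL ℂ 𝒴 𝒳 𝒴 (hop.mkContinuous b hHop)).comp_analyticOnNhd
    (analyticOnNhd_fderiv_Dt hC hCa hC₂ hb hHop hq hRC hDball hDfix)
  have e : (fun B : 𝒴 => hop.mkContinuous b hHop ∘L fderiv ℂ Dt B) =
      ⇑(ContinuousLinearMap.compL ℂ 𝒴 𝒳 𝒴 (hop.mkContinuous b hHop)) ∘ fderiv ℂ Dt := by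
    funext B; simp only [Function.comp_apply, ContinuousLinearMap.compL_apply]
  rw [e]; exact h

/-- **`‖J(B₀)‖ ≤ 18C₂b‖B₀‖`** on `‖B₀‖ < ε` under `9C₂bε ≤ 1/2`
(`B12LinearizAnalytic267.norm_hop_comp_fderiv_Dt_le` + `(1 − 9C₂bε)⁻¹ ≤ 2`). [folklore] -/
theorem norm_jacobianOp_le (hC : QuadAnalytic Ct C₂ R) (hCa : AnalyticOnNhd ℂ Ct {Y : 𝒴 | ‖Y‖ < R})
    (hC₂ : 0 ≤ C₂) (hb : 0 ≤ b) (hHop : ∀ X, ‖hop X‖ ≤ b * ‖X‖) (hq2 : 9 * C₂ * b * ε ≤ 1 / 2)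
    (hRC : 3 * ε ≤ R) (hDball : ∀ B : 𝒴, ‖B‖ < ε → Dt B ∈ closedBall (0:𝒳) (4 * C₂ * ε ^ 2))
    (hDfix : ∀ B : 𝒴, ‖B‖ < ε → Ct (B - hop (Dt B)) = Dt B) {B₀ : 𝒴} (hB₀ : ‖B₀‖ < ε) :
    ‖hop.mkContinuous b hHop ∘L fderiv ℂ Dt B₀‖ ≤ 18 * C₂ * b * ‖B₀‖ :=
  (norm_hop_comp_fderiv_Dt_le hC hCa hC₂ hb hHop (lt_one_of_le_half hq2) hRC hDball hDfix hB₀).trans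
    (bound_le_eighteen hC₂ hb hq2 (norm_nonneg B₀))

/-- **`‖J(B₀)‖ < 1`** on `‖B₀‖ < ε` under `9C₂bε ≤ 1/2` — so the operator logarithm of `DΦ(B₀) = 1 − J(B₀)`
is given by its power series. [folklore] -/
theorem norm_jacobianOp_lt_one (hC : QuadAnalytic Ct C₂ R) (hCa : AnalyticOnNhd ℂ Ct {Y : 𝒴 | ‖Y‖ < R})
    (hC₂ : 0 ≤ C₂) (hb : 0 ≤ b) (hHop : ∀ X, ‖hop X‖ ≤ b * ‖X‖) (hq2 : 9 * C₂ * b * ε ≤ 1 / 2)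
    (hRC : 3 * ε ≤ R) (hDball : ∀ B : 𝒴, ‖B‖ < ε → Dt B ∈ closedBall (0:𝒳) (4 * C₂ * ε ^ 2))
    (hDfix : ∀ B : 𝒴, ‖B‖ < ε → Ct (B - hop (Dt B)) = Dt B) {B₀ : 𝒴} (hB₀ : ‖B₀‖ < ε) :
    ‖hop.mkContinuous b hHop ∘L fderiv ℂ Dt B₀‖ < 1 :=
  (norm_jacobianOp_le hC hCa hC₂ hb hHop hq2 hRC hDball hDfix hB₀).trans_lt
    (eighteen_lt_one hC₂ hb hq2 hB₀)

/-- **`DΦ(B₀) = fderiv ℂ Φ B₀ = 1 − J(B₀)`** in the Banach algebra `𝒴 →L[ℂ] 𝒴`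
(`B12LinearizAnalytic267.hasStrictFDerivAt_phi`, `ContinuousLinearMap.one_def`). [folklore] -/
theorem fderiv_phi (hC : QuadAnalytic Ct C₂ R) (hCa : AnalyticOnNhd ℂ Ct {Y : 𝒴 | ‖Y‖ < R})
    (hC₂ : 0 ≤ C₂) (hb : 0 ≤ b) (hHop : ∀ X, ‖hop X‖ ≤ b * ‖X‖) (hq : 9 * C₂ * b * ε < 1)
    (hRC : 3 * ε ≤ R) (hDball : ∀ B : 𝒴, ‖B‖ < ε → Dt B ∈ closedBall (0:𝒳) (4 * C₂ * ε ^ 2))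
    (hDfix : ∀ B : 𝒴, ‖B‖ < ε → Ct (B - hop (Dt B)) = Dt B) {B₀ : 𝒴} (hB₀ : ‖B₀‖ < ε) :
    fderiv ℂ (fun B => B - hop (Dt B)) B₀ = 1 - hop.mkContinuous b hHop ∘L fderiv ℂ Dt B₀ := by
  rw [(hasStrictFDerivAt_phi hC hCa hC₂ hb hHop hq hRC hDball hDfix hB₀).hasFDerivAt.fderiv,
    ContinuousLinearMap.one_def]

/-- **`DΦ(0) = 1`.** [folklore] -/
theorem fderiv_phi_zero (hC : QuadAnalytic Ct C₂ R) (hCa : AnalyticOnNhd ℂ Ct {Y : 𝒴 | ‖Y‖ < R})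
    (hC₂ : 0 ≤ C₂) (hb : 0 ≤ b) (hHop : ∀ X, ‖hop X‖ ≤ b * ‖X‖) (hq : 9 * C₂ * b * ε < 1)
    (hRC : 3 * ε ≤ R) (hDball : ∀ B : 𝒴, ‖B‖ < ε → Dt B ∈ closedBall (0:𝒳) (4 * C₂ * ε ^ 2))
    (hDfix : ∀ B : 𝒴, ‖B‖ < ε → Ct (B - hop (Dt B)) = Dt B) (hε : 0 < ε) :
    fderiv ℂ (fun B => B - hop (Dt B)) (0 : 𝒴) = 1 := by
  rw [fderiv_phi hC hCa hC₂ hb hHop hq hRC hDball hDfix (by rwa [norm_zero]),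
    jacobianOp_zero hC hCa hC₂ hb hHop hq hRC hDball hDfix hε, sub_zero]

end jacobian

/-! ## §3  The term `log DΦ(B) = mlog (1 − J(B))`: analytic on `‖B‖ < ε`, zero at `B = 0`, `exp` of it `= DΦ(B)`, size -/

section logjacobian

variable {𝒳 𝒴 : Type*} [NormedAddCommGroup 𝒳] [NormedSpace ℂ 𝒳] [CompleteSpace 𝒳]
  [NormedAddCommGroup 𝒴] [NormedSpace ℂ 𝒴] [CompleteSpace 𝒴]
  {hop : 𝒳 →ₗ[ℂ] 𝒴} {Ct : 𝒴 → 𝒳} {C₂ R b ε : ℝ} {Dt : 𝒴 → 𝒳}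

/-- **The (2.12) term is ANALYTIC IN `B`**: `B ↦ log DΦ(B) = mlog (1 − h∘DD̃(B))` is complex-analytic on a
neighbourhood of every point of `‖B‖ < ε`, as a map into the Banach algebra `𝒴 →L[ℂ] 𝒴` (composition of the
analytic `J` of §2 with the analytic operator logarithm of §1 on `‖J‖ < 1`). [folklore] -/
theorem analyticOnNhd_logJacobian (hC : QuadAnalytic Ct C₂ R) (hCa : AnalyticOnNhd ℂ Ct {Y : 𝒴 | ‖Y‖ < R})
    (hC₂ : 0 ≤ C₂) (hb : 0 ≤ b) (hHop : ∀ X, ‖hop X‖ ≤ b * ‖X‖) (hq2 : 9 * C₂ * b * ε ≤ 1 / 2)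
    (hRC : 3 * ε ≤ R) (hDball : ∀ B : 𝒴, ‖B‖ < ε → Dt B ∈ closedBall (0:𝒳) (4 * C₂ * ε ^ 2))
    (hDfix : ∀ B : 𝒴, ‖B‖ < ε → Ct (B - hop (Dt B)) = Dt B) :
    AnalyticOnNhd ℂ (fun B : 𝒴 => mlog (1 - hop.mkContinuous b hHop ∘L fderiv ℂ Dt B)) (ball (0:𝒴) ε) :=
  analyticOnNhd_mlog_one_sub_comp
    (analyticOnNhd_jacobianOp hC hCa hC₂ hb hHop (lt_one_of_le_half hq2) hRC hDball hDfix)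
    (fun _ hB => norm_jacobianOp_lt_one hC hCa hC₂ hb hHop hq2 hRC hDball hDfix (mem_ball_zero_iff.mp hB))

/-- **The term VANISHES AT `B = 0`**: `log DΦ(0) = mlog (1 − 0) = 0` (print, p. 268: «the expression under the
exponential above vanishes at g_k = 0» — this term's share; the argument of `Tr log` in (2.12) is `g_kCB`).
[folklore] -/
theorem logJacobian_zero (hC : QuadAnalytic Ct C₂ R) (hCa : AnalyticOnNhd ℂ Ct {Y : 𝒴 | ‖Y‖ < R})
    (hC₂ : 0 ≤ C₂) (hb : 0 ≤ b) (hHop : ∀ X, ‖hop X‖ ≤ b * ‖X‖) (hq : 9 * C₂ * b * ε < 1)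
    (hRC : 3 * ε ≤ R) (hDball : ∀ B : 𝒴, ‖B‖ < ε → Dt B ∈ closedBall (0:𝒳) (4 * C₂ * ε ^ 2))
    (hDfix : ∀ B : 𝒴, ‖B‖ < ε → Ct (B - hop (Dt B)) = Dt B) (hε : 0 < ε) :
    mlog (1 - hop.mkContinuous b hHop ∘L fderiv ℂ Dt (0 : 𝒴)) = 0 := by
  rw [jacobianOp_zero hC hCa hC₂ hb hHop hq hRC hDball hDfix hε, mlog_one_sub_zero]

/-- **`exp (log DΦ(B₀)) = DΦ(B₀) = 1 − J(B₀)`** for every `‖B₀‖ < ε`. [folklore] -/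
theorem exp_logJacobian (hC : QuadAnalytic Ct C₂ R) (hCa : AnalyticOnNhd ℂ Ct {Y : 𝒴 | ‖Y‖ < R})
    (hC₂ : 0 ≤ C₂) (hb : 0 ≤ b) (hHop : ∀ X, ‖hop X‖ ≤ b * ‖X‖) (hq2 : 9 * C₂ * b * ε ≤ 1 / 2)
    (hRC : 3 * ε ≤ R) (hDball : ∀ B : 𝒴, ‖B‖ < ε → Dt B ∈ closedBall (0:𝒳) (4 * C₂ * ε ^ 2))
    (hDfix : ∀ B : 𝒴, ‖B‖ < ε → Ct (B - hop (Dt B)) = Dt B) {B₀ : 𝒴} (hB₀ : ‖B₀‖ < ε) :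
    exp (mlog (1 - hop.mkContinuous b hHop ∘L fderiv ℂ Dt B₀)) = 1 - hop.mkContinuous b hHop ∘L fderiv ℂ Dt B₀ :=
  exp_mlog_one_sub (norm_jacobianOp_lt_one hC hCa hC₂ hb hHop hq2 hRC hDball hDfix hB₀)

/-- … i.e. `exp (log DΦ(B₀)) = fderiv ℂ Φ B₀`, the derivative of the substitution `Φ(B) = B − hD̃(B)`. [folklore] -/
theorem exp_logJacobian_eq_fderiv_phi (hC : QuadAnalytic Ct C₂ R) (hCa : AnalyticOnNhd ℂ Ct {Y : 𝒴 | ‖Y‖ < R})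
    (hC₂ : 0 ≤ C₂) (hb : 0 ≤ b) (hHop : ∀ X, ‖hop X‖ ≤ b * ‖X‖) (hq2 : 9 * C₂ * b * ε ≤ 1 / 2)
    (hRC : 3 * ε ≤ R) (hDball : ∀ B : 𝒴, ‖B‖ < ε → Dt B ∈ closedBall (0:𝒳) (4 * C₂ * ε ^ 2))
    (hDfix : ∀ B : 𝒴, ‖B‖ < ε → Ct (B - hop (Dt B)) = Dt B) {B₀ : 𝒴} (hB₀ : ‖B₀‖ < ε) :
    exp (mlog (1 - hop.mkContinuous b hHop ∘L fderiv ℂ Dt B₀)) = fderiv ℂ (fun B => B - hop (Dt B)) B₀ := by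
  rw [exp_logJacobian hC hCa hC₂ hb hHop hq2 hRC hDball hDfix hB₀,
    fderiv_phi hC hCa hC₂ hb hHop (lt_one_of_le_half hq2) hRC hDball hDfix hB₀]

/-- **SIZE: `‖log DΦ(B₀)‖ ≤ −log(1 − 18C₂b‖B₀‖)`** for `‖B₀‖ < ε` (`§1` majorant at `‖J(B₀)‖ ≤ 18C₂b‖B₀‖ < 1`).
[folklore] -/
theorem norm_logJacobian_le (hC : QuadAnalytic Ct C₂ R) (hCa : AnalyticOnNhd ℂ Ct {Y : 𝒴 | ‖Y‖ < R})
    (hC₂ : 0 ≤ C₂) (hb : 0 ≤ b) (hHop : ∀ X, ‖hop X‖ ≤ b * ‖X‖) (hq2 : 9 * C₂ * b * ε ≤ 1 / 2)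
    (hRC : 3 * ε ≤ R) (hDball : ∀ B : 𝒴, ‖B‖ < ε → Dt B ∈ closedBall (0:𝒳) (4 * C₂ * ε ^ 2))
    (hDfix : ∀ B : 𝒴, ‖B‖ < ε → Ct (B - hop (Dt B)) = Dt B) {B₀ : 𝒴} (hB₀ : ‖B₀‖ < ε) :
    ‖mlog (1 - hop.mkContinuous b hHop ∘L fderiv ℂ Dt B₀)‖ ≤ -Real.log (1 - 18 * C₂ * b * ‖B₀‖) :=
  norm_mlog_one_sub_le_neg_log_of_le (norm_jacobianOp_le hC hCa hC₂ hb hHop hq2 hRC hDball hDfix hB₀)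
    (eighteen_lt_one hC₂ hb hq2 hB₀)

/-- **LINEAR SIZE on the half ball: `‖log DΦ(B₀)‖ ≤ 36C₂b‖B₀‖`** for `‖B₀‖ ≤ ε/2` (then `‖J(B₀)‖ ≤ 1/2` and
`‖mlog (1 − J)‖ ≤ 2‖J‖`). [folklore] -/
theorem norm_logJacobian_le_linear (hC : QuadAnalytic Ct C₂ R) (hCa : AnalyticOnNhd ℂ Ct {Y : 𝒴 | ‖Y‖ < R})
    (hC₂ : 0 ≤ C₂) (hb : 0 ≤ b) (hHop : ∀ X, ‖hop X‖ ≤ b * ‖X‖) (hq2 : 9 * C₂ * b * ε ≤ 1 / 2)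
    (hRC : 3 * ε ≤ R) (hDball : ∀ B : 𝒴, ‖B‖ < ε → Dt B ∈ closedBall (0:𝒳) (4 * C₂ * ε ^ 2))
    (hDfix : ∀ B : 𝒴, ‖B‖ < ε → Ct (B - hop (Dt B)) = Dt B) {B₀ : 𝒴} (hB₀ : ‖B₀‖ < ε)
    (hhalf : ‖B₀‖ ≤ ε / 2) :
    ‖mlog (1 - hop.mkContinuous b hHop ∘L fderiv ℂ Dt B₀)‖ ≤ 36 * C₂ * b * ‖B₀‖ := by
  have h1 := norm_jacobianOp_le hC hCa hC₂ hb hHop hq2 hRC hDball hDfix hB₀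
  have h2 : ‖hop.mkContinuous b hHop ∘L fderiv ℂ Dt B₀‖ ≤ 1 / 2 :=
    h1.trans (eighteen_le_half hC₂ hb hq2 hhalf)
  calc ‖mlog (1 - hop.mkContinuous b hHop ∘L fderiv ℂ Dt B₀)‖
      ≤ 2 * ‖hop.mkContinuous b hHop ∘L fderiv ℂ Dt B₀‖ := norm_mlog_one_sub_le_two_mul h2
    _ ≤ 2 * (18 * C₂ * b * ‖B₀‖) := by gcongr
    _ = 36 * C₂ * b * ‖B₀‖ := by ring

variable {F : Type*} [NormedAddCommGroup F] [NormedSpace ℂ F]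

/-- **Any continuous linear functional of the term is analytic in `B`** — for `τ : (𝒴 →L[ℂ] 𝒴) →L[ℂ] F`
(the TRACE in finite dimension, §4), `B ↦ τ (log DΦ(B))` is analytic on `‖B‖ < ε`. [folklore] -/
theorem analyticOnNhd_clm_logJacobian (τ : (𝒴 →L[ℂ] 𝒴) →L[ℂ] F) (hC : QuadAnalytic Ct C₂ R)
    (hCa : AnalyticOnNhd ℂ Ct {Y : 𝒴 | ‖Y‖ < R})
    (hC₂ : 0 ≤ C₂) (hb : 0 ≤ b) (hHop : ∀ X, ‖hop X‖ ≤ b * ‖X‖) (hq2 : 9 * C₂ * b * ε ≤ 1 / 2)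
    (hRC : 3 * ε ≤ R) (hDball : ∀ B : 𝒴, ‖B‖ < ε → Dt B ∈ closedBall (0:𝒳) (4 * C₂ * ε ^ 2))
    (hDfix : ∀ B : 𝒴, ‖B‖ < ε → Ct (B - hop (Dt B)) = Dt B) :
    AnalyticOnNhd ℂ (fun B : 𝒴 => τ (mlog (1 - hop.mkContinuous b hHop ∘L fderiv ℂ Dt B))) (ball (0:𝒴) ε) :=
  τ.comp_analyticOnNhd (analyticOnNhd_logJacobian hC hCa hC₂ hb hHop hq2 hRC hDball hDfix)

/-- … it vanishes at `B = 0`, [folklore] -/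
theorem clm_logJacobian_zero (τ : (𝒴 →L[ℂ] 𝒴) →L[ℂ] F) (hC : QuadAnalytic Ct C₂ R)
    (hCa : AnalyticOnNhd ℂ Ct {Y : 𝒴 | ‖Y‖ < R})
    (hC₂ : 0 ≤ C₂) (hb : 0 ≤ b) (hHop : ∀ X, ‖hop X‖ ≤ b * ‖X‖) (hq : 9 * C₂ * b * ε < 1)
    (hRC : 3 * ε ≤ R) (hDball : ∀ B : 𝒴, ‖B‖ < ε → Dt B ∈ closedBall (0:𝒳) (4 * C₂ * ε ^ 2))
    (hDfix : ∀ B : 𝒴, ‖B‖ < ε → Ct (B - hop (Dt B)) = Dt B) (hε : 0 < ε) :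
    τ (mlog (1 - hop.mkContinuous b hHop ∘L fderiv ℂ Dt (0 : 𝒴))) = 0 := by
  rw [logJacobian_zero hC hCa hC₂ hb hHop hq hRC hDball hDfix hε, map_zero]

/-- … and has the size `‖τ (log DΦ(B₀))‖ ≤ ‖τ‖·(−log(1 − 18C₂b‖B₀‖))` for `‖B₀‖ < ε`. [folklore] -/
theorem norm_clm_logJacobian_le (τ : (𝒴 →L[ℂ] 𝒴) →L[ℂ] F) (hC : QuadAnalytic Ct C₂ R)
    (hCa : AnalyticOnNhd ℂ Ct {Y : 𝒴 | ‖Y‖ < R})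
    (hC₂ : 0 ≤ C₂) (hb : 0 ≤ b) (hHop : ∀ X, ‖hop X‖ ≤ b * ‖X‖) (hq2 : 9 * C₂ * b * ε ≤ 1 / 2)
    (hRC : 3 * ε ≤ R) (hDball : ∀ B : 𝒴, ‖B‖ < ε → Dt B ∈ closedBall (0:𝒳) (4 * C₂ * ε ^ 2))
    (hDfix : ∀ B : 𝒴, ‖B‖ < ε → Ct (B - hop (Dt B)) = Dt B) {B₀ : 𝒴} (hB₀ : ‖B₀‖ < ε) :
    ‖τ (mlog (1 - hop.mkContinuous b hHop ∘L fderiv ℂ Dt B₀))‖ ≤ ‖τ‖ * (-Real.log (1 - 18 * C₂ * b * ‖B₀‖)) :=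
  (τ.le_opNorm _).trans
    (mul_le_mul_of_nonneg_left (norm_logJacobian_le hC hCa hC₂ hb hHop hq2 hRC hDball hDfix hB₀) (norm_nonneg _))

end logjacobian

/-! ## §4  Finite dimension: the trace is continuous, `det (exp X) = exp (Tr X)` at operator level, and
`exp (Tr log DΦ(B)) = det DΦ(B)` — the Jacobian identity behind (2.12) -/

section finite

variable {𝒴 : Type*} [NormedAddCommGroup 𝒴] [NormedSpace ℂ 𝒴] [FiniteDimensional ℂ 𝒴]

/-- **The trace is a continuous (linear) functional on `𝒴 →L[ℂ] 𝒴`** in finite dimension (Mathlib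
`LinearMap.continuous_of_finiteDimensional`). [folklore] -/
theorem continuous_trace : Continuous fun T : 𝒴 →L[ℂ] 𝒴 => LinearMap.trace ℂ 𝒴 (T : 𝒴 →ₗ[ℂ] 𝒴) :=
  ((LinearMap.trace ℂ 𝒴) ∘ₗ (ContinuousLinearMap.coeLM ℂ)).continuous_of_finiteDimensional

/-- The trace functional written as a continuous linear map (the term
`LinearMap.toContinuousLinearMap (LinearMap.trace ℂ 𝒴 ∘ₗ ContinuousLinearMap.coeLM ℂ)`; no definition is
introduced) evaluates to the trace. [folklore] -/
theorem traceCLM_apply (T : 𝒴 →L[ℂ] 𝒴) :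
    LinearMap.toContinuousLinearMap ((LinearMap.trace ℂ 𝒴) ∘ₗ (ContinuousLinearMap.coeLM ℂ)) T =
      LinearMap.trace ℂ 𝒴 (T : 𝒴 →ₗ[ℂ] 𝒴) := rfl

open scoped Matrix.Norms.Operator in
/-- **LIOUVILLE'S FORMULA AT OPERATOR LEVEL: `det (exp X) = exp (Tr X)`** for `X : 𝒴 →L[ℂ] 𝒴`, `𝒴` a
finite-dimensional complex normed space.  Proof: transport `exp` through the continuous ring homomorphism
`T ↦ LinearMap.toMatrix b b T` (`b = Module.finBasis ℂ 𝒴`; Mathlib `NormedSpace.map_exp_of_mem_ball`, the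
exponential series having infinite radius over `ℂ`), then the tree's matrix formula
`Literature.Analysis.Matrix.det_exp_eq_exp_trace`, `LinearMap.det_toMatrix`, `LinearMap.trace_eq_matrix_trace`.
[folklore] -/
theorem det_exp_eq_cexp_trace (X : 𝒴 →L[ℂ] 𝒴) :
    LinearMap.det ((exp X : 𝒴 →L[ℂ] 𝒴) : 𝒴 →ₗ[ℂ] 𝒴) =
      Complex.exp (LinearMap.trace ℂ 𝒴 (X : 𝒴 →ₗ[ℂ] 𝒴)) := by
  classical
  haveI : CompleteSpace 𝒴 := FiniteDimensional.complete ℂ 𝒴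
  set bs := Module.finBasis ℂ 𝒴 with hbs
  let φ : (𝒴 →L[ℂ] 𝒴) →+* Matrix (Fin (Module.finrank ℂ 𝒴)) (Fin (Module.finrank ℂ 𝒴)) ℂ :=
    (LinearMap.toMatrixAlgEquiv bs).toRingEquiv.toRingHom.comp ContinuousLinearMap.toLinearMapRingHom
  have hφ : ∀ T : 𝒴 →L[ℂ] 𝒴, φ T = LinearMap.toMatrix bs bs (T : 𝒴 →ₗ[ℂ] 𝒴) := fun T => rfl
  have hφc : Continuous φ := by
    have hψ := ((LinearMap.toMatrix bs bs).toLinearMap ∘ₗ ContinuousLinearMap.coeLM ℂ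
      (M := 𝒴) (N₃ := 𝒴)).continuous_of_finiteDimensional
    exact hψ.congr fun T => rfl
  have hmap : φ (exp X) = exp (φ X) :=
    map_exp_of_mem_ball (𝕂 := ℂ) φ hφc X (Literature.Analysis.Complex.mem_eball_expSeries_radius X)
  rw [← LinearMap.det_toMatrix bs, LinearMap.trace_eq_matrix_trace ℂ bs, ← hφ, ← hφ, hmap,
    Literature.Analysis.Matrix.det_exp_eq_exp_trace, Complex.exp_eq_exp_ℂ]

variable [CompleteSpace 𝒴]

/-- **`exp (Tr log T) = det T`** for `T : 𝒴 →L[ℂ] 𝒴` with `‖T − 1‖ < 1` (operator logarithm `MatrixLog.mlog`;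
`exp (mlog T) = T` and Liouville).  (`CompleteSpace 𝒴` is automatic in finite dimension; it is assumed here
since the operator logarithm lives in the Banach algebra `𝒴 →L[ℂ] 𝒴`.) [folklore] -/
theorem cexp_trace_mlog_eq_det {T : 𝒴 →L[ℂ] 𝒴} (hT : ‖T - 1‖ < 1) :
    Complex.exp (LinearMap.trace ℂ 𝒴 ((mlog T : 𝒴 →L[ℂ] 𝒴) : 𝒴 →ₗ[ℂ] 𝒴)) =
      LinearMap.det (T : 𝒴 →ₗ[ℂ] 𝒴) := by
  rw [← det_exp_eq_cexp_trace, exp_mlog hT]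

/-- Hence `det T ≠ 0` for `‖T − 1‖ < 1`. [folklore] -/
theorem det_ne_zero_of_norm_sub_one_lt {T : 𝒴 →L[ℂ] 𝒴} (hT : ‖T - 1‖ < 1) :
    LinearMap.det (T : 𝒴 →ₗ[ℂ] 𝒴) ≠ 0 := by
  rw [← cexp_trace_mlog_eq_det hT]; exact Complex.exp_ne_zero _

/-- **`|Tr T| ≤ dim 𝒴 · ‖T‖`** for `T : 𝒴 →L[ℂ] 𝒴` and the operator norm of ANY norm on the finite-dimensional
complex space `𝒴`: the trace is the sum of the `dim 𝒴` roots of the characteristic polynomial (Mathlib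
`Module.End.trace_eq_sum_roots_charpoly_of_splits`, `ℂ` algebraically closed), each root is in the spectrum
(`Module.End.mem_spectrum_iff_isRoot_charpoly`, `ContinuousLinearMap.spectrum_eq`), and the spectrum of an element
of the Banach algebra `𝒴 →L[ℂ] 𝒴` lies in the ball of radius `‖T‖·‖1‖ ≤ ‖T‖` (`spectrum.norm_le_norm_mul_of_mem`).
This gives the sizes below the print-style shape (number of variables) × O(1). [folklore] -/
theorem norm_trace_le_finrank_mul_norm (T : 𝒴 →L[ℂ] 𝒴) :
    ‖LinearMap.trace ℂ 𝒴 (T : 𝒴 →ₗ[ℂ] 𝒴)‖ ≤ Module.finrank ℂ 𝒴 * ‖T‖ := by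
  set f : Module.End ℂ 𝒴 := (T : 𝒴 →ₗ[ℂ] 𝒴) with hf
  have hsplit : f.charpoly.Splits := IsAlgClosed.splits _
  have htr : LinearMap.trace ℂ 𝒴 f = f.charpoly.roots.sum :=
    Module.End.trace_eq_sum_roots_charpoly_of_splits hsplit
  have hone : ‖(1 : 𝒴 →L[ℂ] 𝒴)‖ ≤ 1 := by
    rw [ContinuousLinearMap.one_def]; exact ContinuousLinearMap.norm_id_le
  have hroot : ∀ μ ∈ f.charpoly.roots, ‖μ‖ ≤ ‖T‖ := by
    intro μ hμ
    have hμ' : μ ∈ spectrum ℂ f := by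
      rw [Module.End.mem_spectrum_iff_isRoot_charpoly]
      exact (Polynomial.mem_roots (LinearMap.charpoly_monic f).ne_zero).mp hμ
    have hμT : μ ∈ spectrum ℂ T := by rwa [ContinuousLinearMap.spectrum_eq]
    calc ‖μ‖ ≤ ‖T‖ * ‖(1 : 𝒴 →L[ℂ] 𝒴)‖ := spectrum.norm_le_norm_mul_of_mem hμT
      _ ≤ ‖T‖ * 1 := by gcongr
      _ = ‖T‖ := mul_one _
  have hcard : (Multiset.card f.charpoly.roots : ℝ) ≤ Module.finrank ℂ 𝒴 := by
    have h := Polynomial.card_roots' f.charpoly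
    rw [LinearMap.charpoly_natDegree] at h
    exact_mod_cast h
  rw [htr]
  calc ‖f.charpoly.roots.sum‖ ≤ (f.charpoly.roots.map fun μ => ‖μ‖).sum := norm_multiset_sum_le _
    _ ≤ Multiset.card (f.charpoly.roots.map fun μ => ‖μ‖) • ‖T‖ :=
        Multiset.sum_le_card_nsmul _ _ (fun x hx => by
          obtain ⟨μ, hμ, rfl⟩ := Multiset.mem_map.mp hx; exact hroot μ hμ)
    _ = (Multiset.card f.charpoly.roots : ℝ) * ‖T‖ := by rw [Multiset.card_map, nsmul_eq_mul]
    _ ≤ Module.finrank ℂ 𝒴 * ‖T‖ := by gcongr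

/-- Hence **`|Tr log (1 − J)| ≤ dim 𝒴 · (−log(1 − ‖J‖))`** for `J : 𝒴 →L[ℂ] 𝒴`, `‖J‖ < 1`. [folklore] -/
theorem norm_trace_mlog_one_sub_le {J : 𝒴 →L[ℂ] 𝒴} (hJ : ‖J‖ < 1) :
    ‖LinearMap.trace ℂ 𝒴 ((mlog (1 - J) : 𝒴 →L[ℂ] 𝒴) : 𝒴 →ₗ[ℂ] 𝒴)‖ ≤
      Module.finrank ℂ 𝒴 * (-Real.log (1 - ‖J‖)) :=
  (norm_trace_le_finrank_mul_norm _).trans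
    (mul_le_mul_of_nonneg_left (norm_mlog_one_sub_le_neg_log hJ) (Nat.cast_nonneg _))

variable {𝒳 : Type*} [NormedAddCommGroup 𝒳] [NormedSpace ℂ 𝒳] [CompleteSpace 𝒳]
  {hop : 𝒳 →ₗ[ℂ] 𝒴} {Ct : 𝒴 → 𝒳} {C₂ R b ε : ℝ} {Dt : 𝒴 → 𝒳}

/-- **THE JACOBIAN IDENTITY BEHIND (2.12): `exp (Tr log DΦ(B₀)) = det DΦ(B₀)`** for every `‖B₀‖ < ε` — the factor
`exp[Tr log(I − h(δ/δB)D̃)]` under the integral is the Jacobian determinant of the substitution `B′ = B − hD̃(B)`.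
[folklore] -/
theorem cexp_trace_logJacobian (hC : QuadAnalytic Ct C₂ R) (hCa : AnalyticOnNhd ℂ Ct {Y : 𝒴 | ‖Y‖ < R})
    (hC₂ : 0 ≤ C₂) (hb : 0 ≤ b) (hHop : ∀ X, ‖hop X‖ ≤ b * ‖X‖) (hq2 : 9 * C₂ * b * ε ≤ 1 / 2)
    (hRC : 3 * ε ≤ R) (hDball : ∀ B : 𝒴, ‖B‖ < ε → Dt B ∈ closedBall (0:𝒳) (4 * C₂ * ε ^ 2))
    (hDfix : ∀ B : 𝒴, ‖B‖ < ε → Ct (B - hop (Dt B)) = Dt B) {B₀ : 𝒴} (hB₀ : ‖B₀‖ < ε) :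
    Complex.exp (LinearMap.trace ℂ 𝒴
        ((mlog (1 - hop.mkContinuous b hHop ∘L fderiv ℂ Dt B₀) : 𝒴 →L[ℂ] 𝒴) : 𝒴 →ₗ[ℂ] 𝒴)) =
      LinearMap.det (((1 : 𝒴 →L[ℂ] 𝒴) - hop.mkContinuous b hHop ∘L fderiv ℂ Dt B₀ : 𝒴 →L[ℂ] 𝒴) :
        𝒴 →ₗ[ℂ] 𝒴) :=
  cexp_trace_mlog_eq_det (by
    rw [norm_one_sub_sub_one]; exact norm_jacobianOp_lt_one hC hCa hC₂ hb hHop hq2 hRC hDball hDfix hB₀)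

/-- … `= det (fderiv ℂ Φ B₀)`, the Jacobian determinant of `Φ(B) = B − hD̃(B)` at `B₀`. [folklore] -/
theorem cexp_trace_logJacobian_eq_det_fderiv_phi (hC : QuadAnalytic Ct C₂ R)
    (hCa : AnalyticOnNhd ℂ Ct {Y : 𝒴 | ‖Y‖ < R})
    (hC₂ : 0 ≤ C₂) (hb : 0 ≤ b) (hHop : ∀ X, ‖hop X‖ ≤ b * ‖X‖) (hq2 : 9 * C₂ * b * ε ≤ 1 / 2)
    (hRC : 3 * ε ≤ R) (hDball : ∀ B : 𝒴, ‖B‖ < ε → Dt B ∈ closedBall (0:𝒳) (4 * C₂ * ε ^ 2))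
    (hDfix : ∀ B : 𝒴, ‖B‖ < ε → Ct (B - hop (Dt B)) = Dt B) {B₀ : 𝒴} (hB₀ : ‖B₀‖ < ε) :
    Complex.exp (LinearMap.trace ℂ 𝒴
        ((mlog (1 - hop.mkContinuous b hHop ∘L fderiv ℂ Dt B₀) : 𝒴 →L[ℂ] 𝒴) : 𝒴 →ₗ[ℂ] 𝒴)) =
      LinearMap.det ((fderiv ℂ (fun B => B - hop (Dt B)) B₀ : 𝒴 →L[ℂ] 𝒴) : 𝒴 →ₗ[ℂ] 𝒴) := by
  rw [cexp_trace_logJacobian hC hCa hC₂ hb hHop hq2 hRC hDball hDfix hB₀,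
    fderiv_phi hC hCa hC₂ hb hHop (lt_one_of_le_half hq2) hRC hDball hDfix hB₀]

/-- **The Jacobian determinant does not vanish** on `‖B₀‖ < ε`. [folklore] -/
theorem det_jacobian_ne_zero (hC : QuadAnalytic Ct C₂ R) (hCa : AnalyticOnNhd ℂ Ct {Y : 𝒴 | ‖Y‖ < R})
    (hC₂ : 0 ≤ C₂) (hb : 0 ≤ b) (hHop : ∀ X, ‖hop X‖ ≤ b * ‖X‖) (hq2 : 9 * C₂ * b * ε ≤ 1 / 2)
    (hRC : 3 * ε ≤ R) (hDball : ∀ B : 𝒴, ‖B‖ < ε → Dt B ∈ closedBall (0:𝒳) (4 * C₂ * ε ^ 2))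
    (hDfix : ∀ B : 𝒴, ‖B‖ < ε → Ct (B - hop (Dt B)) = Dt B) {B₀ : 𝒴} (hB₀ : ‖B₀‖ < ε) :
    LinearMap.det ((fderiv ℂ (fun B => B - hop (Dt B)) B₀ : 𝒴 →L[ℂ] 𝒴) : 𝒴 →ₗ[ℂ] 𝒴) ≠ 0 := by
  rw [← cexp_trace_logJacobian_eq_det_fderiv_phi hC hCa hC₂ hb hHop hq2 hRC hDball hDfix hB₀]
  exact Complex.exp_ne_zero _

/-- **The Jacobian determinant `B ↦ det DΦ(B) = det (fderiv ℂ Φ B)` is an ANALYTIC function of `B`** on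
`‖B‖ < ε` (it is `exp ∘ Tr log DΦ` there). [folklore] -/
theorem analyticOnNhd_det_jacobian (hC : QuadAnalytic Ct C₂ R) (hCa : AnalyticOnNhd ℂ Ct {Y : 𝒴 | ‖Y‖ < R})
    (hC₂ : 0 ≤ C₂) (hb : 0 ≤ b) (hHop : ∀ X, ‖hop X‖ ≤ b * ‖X‖) (hq2 : 9 * C₂ * b * ε ≤ 1 / 2)
    (hRC : 3 * ε ≤ R) (hDball : ∀ B : 𝒴, ‖B‖ < ε → Dt B ∈ closedBall (0:𝒳) (4 * C₂ * ε ^ 2))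
    (hDfix : ∀ B : 𝒴, ‖B‖ < ε → Ct (B - hop (Dt B)) = Dt B) :
    AnalyticOnNhd ℂ (fun B : 𝒴 =>
      LinearMap.det ((fderiv ℂ (fun B => B - hop (Dt B)) B : 𝒴 →L[ℂ] 𝒴) : 𝒴 →ₗ[ℂ] 𝒴)) (ball (0:𝒴) ε) := by
  have h1 : AnalyticOnNhd ℂ (fun B : 𝒴 => LinearMap.trace ℂ 𝒴
      ((mlog (1 - hop.mkContinuous b hHop ∘L fderiv ℂ Dt B) : 𝒴 →L[ℂ] 𝒴) : 𝒴 →ₗ[ℂ] 𝒴)) (ball (0:𝒴) ε) :=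
    analyticOnNhd_clm_logJacobian
      (LinearMap.toContinuousLinearMap ((LinearMap.trace ℂ 𝒴) ∘ₗ (ContinuousLinearMap.coeLM ℂ)))
      hC hCa hC₂ hb hHop hq2 hRC hDball hDfix
  have h2 : AnalyticOnNhd ℂ (fun B : 𝒴 => Complex.exp (LinearMap.trace ℂ 𝒴
      ((mlog (1 - hop.mkContinuous b hHop ∘L fderiv ℂ Dt B) : 𝒴 →L[ℂ] 𝒴) : 𝒴 →ₗ[ℂ] 𝒴))) (ball (0:𝒴) ε) :=
    fun B hB => analyticAt_cexp.comp (h1 B hB)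
  exact h2.congr isOpen_ball fun B hB =>
    cexp_trace_logJacobian_eq_det_fderiv_phi hC hCa hC₂ hb hHop hq2 hRC hDball hDfix (mem_ball_zero_iff.mp hB)

omit [FiniteDimensional ℂ 𝒴] in
/-- **At `B = 0` the Jacobian determinant is `1`.** [folklore] -/
theorem det_jacobian_zero (hC : QuadAnalytic Ct C₂ R) (hCa : AnalyticOnNhd ℂ Ct {Y : 𝒴 | ‖Y‖ < R})
    (hC₂ : 0 ≤ C₂) (hb : 0 ≤ b) (hHop : ∀ X, ‖hop X‖ ≤ b * ‖X‖) (hq : 9 * C₂ * b * ε < 1)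
    (hRC : 3 * ε ≤ R) (hDball : ∀ B : 𝒴, ‖B‖ < ε → Dt B ∈ closedBall (0:𝒳) (4 * C₂ * ε ^ 2))
    (hDfix : ∀ B : 𝒴, ‖B‖ < ε → Ct (B - hop (Dt B)) = Dt B) (hε : 0 < ε) :
    LinearMap.det ((fderiv ℂ (fun B => B - hop (Dt B)) (0 : 𝒴) : 𝒴 →L[ℂ] 𝒴) : 𝒴 →ₗ[ℂ] 𝒴) = 1 := by
  rw [fderiv_phi_zero hC hCa hC₂ hb hHop hq hRC hDball hDfix hε]
  simp

/-- **`Tr log DΦ(B)` is ANALYTIC on `‖B‖ < ε`** (the trace is a continuous linear functional, §3). [folklore] -/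
theorem analyticOnNhd_trace_logJacobian (hC : QuadAnalytic Ct C₂ R)
    (hCa : AnalyticOnNhd ℂ Ct {Y : 𝒴 | ‖Y‖ < R})
    (hC₂ : 0 ≤ C₂) (hb : 0 ≤ b) (hHop : ∀ X, ‖hop X‖ ≤ b * ‖X‖) (hq2 : 9 * C₂ * b * ε ≤ 1 / 2)
    (hRC : 3 * ε ≤ R) (hDball : ∀ B : 𝒴, ‖B‖ < ε → Dt B ∈ closedBall (0:𝒳) (4 * C₂ * ε ^ 2))
    (hDfix : ∀ B : 𝒴, ‖B‖ < ε → Ct (B - hop (Dt B)) = Dt B) :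
    AnalyticOnNhd ℂ (fun B : 𝒴 => LinearMap.trace ℂ 𝒴
      ((mlog (1 - hop.mkContinuous b hHop ∘L fderiv ℂ Dt B) : 𝒴 →L[ℂ] 𝒴) : 𝒴 →ₗ[ℂ] 𝒴)) (ball (0:𝒴) ε) :=
  analyticOnNhd_clm_logJacobian
    (LinearMap.toContinuousLinearMap ((LinearMap.trace ℂ 𝒴) ∘ₗ (ContinuousLinearMap.coeLM ℂ)))
    hC hCa hC₂ hb hHop hq2 hRC hDball hDfix

omit [FiniteDimensional ℂ 𝒴] in
/-- **`Tr log DΦ(0) = 0`.** [folklore] -/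
theorem trace_logJacobian_zero (hC : QuadAnalytic Ct C₂ R) (hCa : AnalyticOnNhd ℂ Ct {Y : 𝒴 | ‖Y‖ < R})
    (hC₂ : 0 ≤ C₂) (hb : 0 ≤ b) (hHop : ∀ X, ‖hop X‖ ≤ b * ‖X‖) (hq : 9 * C₂ * b * ε < 1)
    (hRC : 3 * ε ≤ R) (hDball : ∀ B : 𝒴, ‖B‖ < ε → Dt B ∈ closedBall (0:𝒳) (4 * C₂ * ε ^ 2))
    (hDfix : ∀ B : 𝒴, ‖B‖ < ε → Ct (B - hop (Dt B)) = Dt B) (hε : 0 < ε) :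
    LinearMap.trace ℂ 𝒴
      ((mlog (1 - hop.mkContinuous b hHop ∘L fderiv ℂ Dt (0 : 𝒴)) : 𝒴 →L[ℂ] 𝒴) : 𝒴 →ₗ[ℂ] 𝒴) = 0 := by
  rw [logJacobian_zero hC hCa hC₂ hb hHop hq hRC hDball hDfix hε]
  simp

/-- **SIZE of `Tr log DΦ(B₀)`: `≤ ‖Tr‖·(−log(1 − 18C₂b‖B₀‖))`**, `‖Tr‖` the operator norm of the trace functional
on `𝒴 →L[ℂ] 𝒴` for the chosen norm of `𝒴` (the intrinsic form with `dim 𝒴` in place of `‖Tr‖` is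
`norm_trace_logJacobian_le_finrank` below). [folklore] -/
theorem norm_trace_logJacobian_le (hC : QuadAnalytic Ct C₂ R) (hCa : AnalyticOnNhd ℂ Ct {Y : 𝒴 | ‖Y‖ < R})
    (hC₂ : 0 ≤ C₂) (hb : 0 ≤ b) (hHop : ∀ X, ‖hop X‖ ≤ b * ‖X‖) (hq2 : 9 * C₂ * b * ε ≤ 1 / 2)
    (hRC : 3 * ε ≤ R) (hDball : ∀ B : 𝒴, ‖B‖ < ε → Dt B ∈ closedBall (0:𝒳) (4 * C₂ * ε ^ 2))
    (hDfix : ∀ B : 𝒴, ‖B‖ < ε → Ct (B - hop (Dt B)) = Dt B) {B₀ : 𝒴} (hB₀ : ‖B₀‖ < ε) :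
    ‖LinearMap.trace ℂ 𝒴
        ((mlog (1 - hop.mkContinuous b hHop ∘L fderiv ℂ Dt B₀) : 𝒴 →L[ℂ] 𝒴) : 𝒴 →ₗ[ℂ] 𝒴)‖ ≤
      ‖LinearMap.toContinuousLinearMap ((LinearMap.trace ℂ 𝒴) ∘ₗ (ContinuousLinearMap.coeLM ℂ (M := 𝒴)
          (N₃ := 𝒴)))‖ * (-Real.log (1 - 18 * C₂ * b * ‖B₀‖)) :=
  norm_clm_logJacobian_le
    (LinearMap.toContinuousLinearMap ((LinearMap.trace ℂ 𝒴) ∘ₗ (ContinuousLinearMap.coeLM ℂ)))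
    hC hCa hC₂ hb hHop hq2 hRC hDball hDfix hB₀

/-- **SIZE of `Tr log DΦ(B₀)`, intrinsic form: `≤ dim 𝒴 · (−log(1 − 18C₂b‖B₀‖))`** for `‖B₀‖ < ε` — the number
of variables times an `O(1)` function of `18C₂b‖B₀‖ < 1` (`norm_trace_le_finrank_mul_norm` + §3). [folklore] -/
theorem norm_trace_logJacobian_le_finrank (hC : QuadAnalytic Ct C₂ R)
    (hCa : AnalyticOnNhd ℂ Ct {Y : 𝒴 | ‖Y‖ < R})
    (hC₂ : 0 ≤ C₂) (hb : 0 ≤ b) (hHop : ∀ X, ‖hop X‖ ≤ b * ‖X‖) (hq2 : 9 * C₂ * b * ε ≤ 1 / 2)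
    (hRC : 3 * ε ≤ R) (hDball : ∀ B : 𝒴, ‖B‖ < ε → Dt B ∈ closedBall (0:𝒳) (4 * C₂ * ε ^ 2))
    (hDfix : ∀ B : 𝒴, ‖B‖ < ε → Ct (B - hop (Dt B)) = Dt B) {B₀ : 𝒴} (hB₀ : ‖B₀‖ < ε) :
    ‖LinearMap.trace ℂ 𝒴
        ((mlog (1 - hop.mkContinuous b hHop ∘L fderiv ℂ Dt B₀) : 𝒴 →L[ℂ] 𝒴) : 𝒴 →ₗ[ℂ] 𝒴)‖ ≤
      Module.finrank ℂ 𝒴 * (-Real.log (1 - 18 * C₂ * b * ‖B₀‖)) :=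
  (norm_trace_le_finrank_mul_norm _).trans
    (mul_le_mul_of_nonneg_left (norm_logJacobian_le hC hCa hC₂ hb hHop hq2 hRC hDball hDfix hB₀)
      (Nat.cast_nonneg _))

/-- … and the LINEAR intrinsic size `|Tr log DΦ(B₀)| ≤ 36 · dim 𝒴 · C₂b‖B₀‖` on the half ball `‖B₀‖ ≤ ε/2`.
[folklore] -/
theorem norm_trace_logJacobian_le_linear (hC : QuadAnalytic Ct C₂ R)
    (hCa : AnalyticOnNhd ℂ Ct {Y : 𝒴 | ‖Y‖ < R})
    (hC₂ : 0 ≤ C₂) (hb : 0 ≤ b) (hHop : ∀ X, ‖hop X‖ ≤ b * ‖X‖) (hq2 : 9 * C₂ * b * ε ≤ 1 / 2)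
    (hRC : 3 * ε ≤ R) (hDball : ∀ B : 𝒴, ‖B‖ < ε → Dt B ∈ closedBall (0:𝒳) (4 * C₂ * ε ^ 2))
    (hDfix : ∀ B : 𝒴, ‖B‖ < ε → Ct (B - hop (Dt B)) = Dt B) {B₀ : 𝒴} (hB₀ : ‖B₀‖ < ε)
    (hhalf : ‖B₀‖ ≤ ε / 2) :
    ‖LinearMap.trace ℂ 𝒴
        ((mlog (1 - hop.mkContinuous b hHop ∘L fderiv ℂ Dt B₀) : 𝒴 →L[ℂ] 𝒴) : 𝒴 →ₗ[ℂ] 𝒴)‖ ≤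
      Module.finrank ℂ 𝒴 * (36 * C₂ * b * ‖B₀‖) :=
  (norm_trace_le_finrank_mul_norm _).trans
    (mul_le_mul_of_nonneg_left (norm_logJacobian_le_linear hC hCa hC₂ hb hHop hq2 hRC hDball hDfix hB₀ hhalf)
      (Nat.cast_nonneg _))

end finite

/-! ## §5  The (2.12) term «Tr log(I − h((δ/δB)D̃)(g_kCB))», assembled (transcription) -/

section transcription

variable {𝒳 𝒴 : Type*} [NormedAddCommGroup 𝒳] [NormedSpace ℂ 𝒳] [CompleteSpace 𝒳]
  [NormedAddCommGroup 𝒴] [NormedSpace ℂ 𝒴] [CompleteSpace 𝒴]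

/-- **B12 (2.12) p. 268, the term «Tr log(I − h((δ/δB)D̃)(g_kCB))» of the new action, in the typing of this file
(OPERATOR PART, any complex Banach spaces).**  For the solution `D̃` of `C̃(B − hD̃(B)) = D̃(B)` on `‖B‖ < ε` of
`B12Lineariz267.p267_linearizing_change_of_variables` (any `D̃` with values in the ball `4C₂ε²` solving the
equation), under the hypotheses of `B12LinearizAnalytic267.p267_analytic_function_of_B` with the contraction constant
`9C₂bε ≤ 1/2`: writing `J(B) = h∘DD̃(B)` and `log DΦ(B) = mlog (1 − J(B))` — (i) `B ↦ log DΦ(B)` is complex-analytic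
on `‖B‖ < ε`; (ii) for `ε > 0` it vanishes at `B = 0` («the expression under the exponential above vanishes at
g_k = 0», this term's share); (iii) for every `‖B₀‖ < ε`: `‖J(B₀)‖ ≤ 18C₂b‖B₀‖ < 1`,
`exp (log DΦ(B₀)) = 1 − J(B₀) = fderiv ℂ Φ B₀` (`Φ(B) = B − hD̃(B)`), and `‖log DΦ(B₀)‖ ≤ −log(1 − 18C₂b‖B₀‖)`.
A transcription onto the tree's operator logarithm and Mathlib's analytic calculus; the trace/determinant reading is
`p268_TrLog_jacobian_term_findim`; reality for real `B` and the other terms of 𝐏⁽ᵏ⁾ are NOT typed.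
[cite: Balaban1987RG1, (2.12) p.268] -/
theorem p268_TrLog_jacobian_term {hop : 𝒳 →ₗ[ℂ] 𝒴} {Ct : 𝒴 → 𝒳} {C₂ R b ε : ℝ} {Dt : 𝒴 → 𝒳}
    (hC : B13Contraction113.QuadAnalytic Ct C₂ R) (hCa : AnalyticOnNhd ℂ Ct {Y : 𝒴 | ‖Y‖ < R})
    (hC₂ : 0 ≤ C₂) (hb : 0 ≤ b) (hHop : ∀ X, ‖hop X‖ ≤ b * ‖X‖) (hq2 : 9 * C₂ * b * ε ≤ 1 / 2)
    (hRC : 3 * ε ≤ R) (hDball : ∀ B : 𝒴, ‖B‖ < ε → Dt B ∈ closedBall (0:𝒳) (4 * C₂ * ε ^ 2))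
    (hDfix : ∀ B : 𝒴, ‖B‖ < ε → Ct (B - hop (Dt B)) = Dt B) :
    AnalyticOnNhd ℂ (fun B : 𝒴 => mlog (1 - hop.mkContinuous b hHop ∘L fderiv ℂ Dt B)) (ball (0:𝒴) ε) ∧
      (0 < ε → mlog (1 - hop.mkContinuous b hHop ∘L fderiv ℂ Dt (0 : 𝒴)) = 0) ∧
      (∀ B₀ : 𝒴, ‖B₀‖ < ε →
        ‖hop.mkContinuous b hHop ∘L fderiv ℂ Dt B₀‖ ≤ 18 * C₂ * b * ‖B₀‖ ∧
        ‖hop.mkContinuous b hHop ∘L fderiv ℂ Dt B₀‖ < 1 ∧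
        exp (mlog (1 - hop.mkContinuous b hHop ∘L fderiv ℂ Dt B₀)) =
          1 - hop.mkContinuous b hHop ∘L fderiv ℂ Dt B₀ ∧
        exp (mlog (1 - hop.mkContinuous b hHop ∘L fderiv ℂ Dt B₀)) = fderiv ℂ (fun B => B - hop (Dt B)) B₀ ∧
        ‖mlog (1 - hop.mkContinuous b hHop ∘L fderiv ℂ Dt B₀)‖ ≤ -Real.log (1 - 18 * C₂ * b * ‖B₀‖)) :=
  ⟨analyticOnNhd_logJacobian hC hCa hC₂ hb hHop hq2 hRC hDball hDfix,
    fun hε => logJacobian_zero hC hCa hC₂ hb hHop (lt_one_of_le_half hq2) hRC hDball hDfix hε,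
    fun _ hB₀ =>
      ⟨norm_jacobianOp_le hC hCa hC₂ hb hHop hq2 hRC hDball hDfix hB₀,
        norm_jacobianOp_lt_one hC hCa hC₂ hb hHop hq2 hRC hDball hDfix hB₀,
        exp_logJacobian hC hCa hC₂ hb hHop hq2 hRC hDball hDfix hB₀,
        exp_logJacobian_eq_fderiv_phi hC hCa hC₂ hb hHop hq2 hRC hDball hDfix hB₀,
        norm_logJacobian_le hC hCa hC₂ hb hHop hq2 hRC hDball hDfix hB₀⟩⟩

/-- **B12 (2.12) p. 268, the term «Tr log(I − h((δ/δB)D̃)(g_kCB))» — TRACE / DETERMINANT PART (finite dimension,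
the situation of the finite lattice).**  Under the same hypotheses with `𝒴` finite-dimensional: (i)
`B ↦ Tr log DΦ(B)` and the Jacobian determinant `B ↦ det (fderiv ℂ Φ B)` are complex-analytic on `‖B‖ < ε`; (ii) for `ε > 0`, `Tr log DΦ(0) = 0` and `det DΦ(0) = 1`;
(iii) for every `‖B₀‖ < ε`: `exp (Tr log DΦ(B₀)) = det DΦ(B₀) = det (fderiv ℂ Φ B₀) ≠ 0` — the exponential of the
(2.12) term is the Jacobian determinant of the substitution `B′ = B − hD̃(B)` — and the size
`|Tr log DΦ(B₀)| ≤ dim 𝒴 · (−log(1 − 18C₂b‖B₀‖))` (the number of variables times an `O(1)` function, valid for the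
operator norm of any norm on `𝒴`).  The identification with the principal-branch `log det`, reality and positivity
for real `B`, and the print's constants are NOT typed. [cite: Balaban1987RG1, (2.12) p.268] -/
theorem p268_TrLog_jacobian_term_findim [FiniteDimensional ℂ 𝒴] {hop : 𝒳 →ₗ[ℂ] 𝒴} {Ct : 𝒴 → 𝒳}
    {C₂ R b ε : ℝ} {Dt : 𝒴 → 𝒳}
    (hC : B13Contraction113.QuadAnalytic Ct C₂ R) (hCa : AnalyticOnNhd ℂ Ct {Y : 𝒴 | ‖Y‖ < R})
    (hC₂ : 0 ≤ C₂) (hb : 0 ≤ b) (hHop : ∀ X, ‖hop X‖ ≤ b * ‖X‖) (hq2 : 9 * C₂ * b * ε ≤ 1 / 2)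
    (hRC : 3 * ε ≤ R) (hDball : ∀ B : 𝒴, ‖B‖ < ε → Dt B ∈ closedBall (0:𝒳) (4 * C₂ * ε ^ 2))
    (hDfix : ∀ B : 𝒴, ‖B‖ < ε → Ct (B - hop (Dt B)) = Dt B) :
    AnalyticOnNhd ℂ (fun B : 𝒴 => LinearMap.trace ℂ 𝒴
        ((mlog (1 - hop.mkContinuous b hHop ∘L fderiv ℂ Dt B) : 𝒴 →L[ℂ] 𝒴) : 𝒴 →ₗ[ℂ] 𝒴)) (ball (0:𝒴) ε) ∧
      AnalyticOnNhd ℂ (fun B : 𝒴 =>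
        LinearMap.det ((fderiv ℂ (fun B => B - hop (Dt B)) B : 𝒴 →L[ℂ] 𝒴) : 𝒴 →ₗ[ℂ] 𝒴)) (ball (0:𝒴) ε) ∧
      (0 < ε →
        LinearMap.trace ℂ 𝒴
            ((mlog (1 - hop.mkContinuous b hHop ∘L fderiv ℂ Dt (0 : 𝒴)) : 𝒴 →L[ℂ] 𝒴) : 𝒴 →ₗ[ℂ] 𝒴) = 0 ∧
          LinearMap.det ((fderiv ℂ (fun B => B - hop (Dt B)) (0 : 𝒴) : 𝒴 →L[ℂ] 𝒴) : 𝒴 →ₗ[ℂ] 𝒴) = 1) ∧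
      (∀ B₀ : 𝒴, ‖B₀‖ < ε →
        Complex.exp (LinearMap.trace ℂ 𝒴
            ((mlog (1 - hop.mkContinuous b hHop ∘L fderiv ℂ Dt B₀) : 𝒴 →L[ℂ] 𝒴) : 𝒴 →ₗ[ℂ] 𝒴)) =
          LinearMap.det (((1 : 𝒴 →L[ℂ] 𝒴) - hop.mkContinuous b hHop ∘L fderiv ℂ Dt B₀ : 𝒴 →L[ℂ] 𝒴) :
            𝒴 →ₗ[ℂ] 𝒴) ∧
        Complex.exp (LinearMap.trace ℂ 𝒴
            ((mlog (1 - hop.mkContinuous b hHop ∘L fderiv ℂ Dt B₀) : 𝒴 →L[ℂ] 𝒴) : 𝒴 →ₗ[ℂ] 𝒴)) =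
          LinearMap.det ((fderiv ℂ (fun B => B - hop (Dt B)) B₀ : 𝒴 →L[ℂ] 𝒴) : 𝒴 →ₗ[ℂ] 𝒴) ∧
        LinearMap.det ((fderiv ℂ (fun B => B - hop (Dt B)) B₀ : 𝒴 →L[ℂ] 𝒴) : 𝒴 →ₗ[ℂ] 𝒴) ≠ 0 ∧
        ‖LinearMap.trace ℂ 𝒴
            ((mlog (1 - hop.mkContinuous b hHop ∘L fderiv ℂ Dt B₀) : 𝒴 →L[ℂ] 𝒴) : 𝒴 →ₗ[ℂ] 𝒴)‖ ≤
          Module.finrank ℂ 𝒴 * (-Real.log (1 - 18 * C₂ * b * ‖B₀‖))) :=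
  ⟨analyticOnNhd_trace_logJacobian hC hCa hC₂ hb hHop hq2 hRC hDball hDfix,
    analyticOnNhd_det_jacobian hC hCa hC₂ hb hHop hq2 hRC hDball hDfix,
    fun hε =>
      ⟨trace_logJacobian_zero hC hCa hC₂ hb hHop (lt_one_of_le_half hq2) hRC hDball hDfix hε,
        det_jacobian_zero hC hCa hC₂ hb hHop (lt_one_of_le_half hq2) hRC hDball hDfix hε⟩,
    fun _ hB₀ =>
      ⟨cexp_trace_logJacobian hC hCa hC₂ hb hHop hq2 hRC hDball hDfix hB₀,
        cexp_trace_logJacobian_eq_det_fderiv_phi hC hCa hC₂ hb hHop hq2 hRC hDball hDfix hB₀,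
        det_jacobian_ne_zero hC hCa hC₂ hb hHop hq2 hRC hDball hDfix hB₀,
        norm_trace_logJacobian_le_finrank hC hCa hC₂ hb hHop hq2 hRC hDball hDfix hB₀⟩⟩

/-- Non-vacuity of the hypothesis set: the degenerate model `𝒳 = 𝒴 = ℂ` (finite-dimensional), `h = id`, `C̃ = 0`,
`D̃ = 0`, `C₂ = 0`, `b = 1`, `ε = 1`, `R = 3` satisfies all nine hypotheses of both transcription theorems.
[folklore] -/
example := p268_TrLog_jacobian_term (𝒳 := ℂ) (𝒴 := ℂ) (hop := LinearMap.id) (Ct := fun _ => 0)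
  (C₂ := 0) (R := 3) (b := 1) (ε := 1) (Dt := fun _ => 0)
  ⟨fun Y _ => by simp, fun P Q => differentiableOn_const (0:ℂ)⟩ (fun Y _ => analyticAt_const) le_rfl
  zero_le_one (fun X => by simp) (by norm_num) (by norm_num) (fun B _ => by simp) (fun B _ => by simp)

/-- The same degenerate model for the finite-dimensional transcription theorem. [folklore] -/
example := p268_TrLog_jacobian_term_findim (𝒳 := ℂ) (𝒴 := ℂ) (hop := LinearMap.id) (Ct := fun _ => 0)
  (C₂ := 0) (R := 3) (b := 1) (ε := 1) (Dt := fun _ => 0)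
  ⟨fun Y _ => by simp, fun P Q => differentiableOn_const (0:ℂ)⟩ (fun Y _ => analyticAt_const) le_rfl
  zero_le_one (fun X => by simp) (by norm_num) (by norm_num) (fun B _ => by simp) (fun B _ => by simp)

end transcription

end Literature.MathematicalPhysics.QuantumFieldTheory.Balaban1983to89.B12JacobianTrLog268
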